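import Mathlib.Analysis.Calculus.BumpFunction.FiniteDimension
import Summits.QuantumFields.BalabanUV.Beta.FP.BoxAverageGerm

/-!
# `BalabanUV.Beta.FP.BoxAverageGermLocal` — road «FP» for binder row D1, N7 PLAN v1 §3, row «N7/GERM-x» of `LEAVES-FP.md`, SUPPLEMENT: THE
# BOX-AVERAGE GERM LEMMA FOR KERNELS SMOOTH ONLY OFF THE UNIT BALL (e.g. `x ↦ ∇ʲ(1/|x|²)`-type components, singular at the origin) — the GLOBAL
# `ContDiff ℝ 4 f` hypothesis of `FP/BoxAverageGerm` replaced by `ContDiffOn ℝ 4 f {x | 1 < ‖x‖}` via a smooth cutoff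
# (β sub-cell; CROSS-LANE supplier seat `b2b-balaban-gan24-formalise-leaf-04` (G-an2-4 formalisation swarm, gen 36); parts 1–2 =
# `FP/BoxAverageMoments` p226497, `FP/BoxAverageGerm` p226750)

NOT IN PRINT AS SUCH; OUR BOOKKEEPING.  HONEST FRAMING (cell charter, verbatim): «discharging `BetaPertH` makes Bałaban's UV stability UNCONDITIONAL —
a real constructive-QFT result; it is NOT the continuum limit and NOT the Clay problem.»  HONEST DEPENDENCY (verbatim): «continuum YM on T⁴ ⇐ BetaPertH ∧
nine spine estimates (0/9 proved); BetaPertH ⇐ (D1) ∧ (D4) ∧ CAP+tail; G-an2-4 gates asym, D1 and NE2/3/4.»  ABSOLUTE RULE (cell, verbatim): «No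
internally-minted statement may enter as a cited fact. Every hypothesis is either kernel-proved in this package or a verbatim quotation of a PUBLISHED
theorem with page reference.»  Nothing is cited; no `def`; no `def … : Prop`; Mathlib (`ContDiffBump` on a finite-dimensional space) + parts 1–2 only;
NO road input; discharges NOTHING of N7 ∕ `hasym` ∕ D1; NOT `BetaPertH`, NOT continuum, NOT Clay.

CONTENT (`ι` finite, `ι → ℝ` with the SUP norm, `box ι = Icc (−½) ½`, `e_i = Pi.single i 1`).
* [folklore] `exists_contDiff_extension_off_ball` — for `f` of class `C⁴` on the open set `{x | 1 < ‖x‖}` there is a GLOBALLY `C⁴` function `g` with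
  `g = f` near every point of `{x | 7/4 < ‖x‖}` (cutoff `1 − φ`, `φ` a `ContDiffBump 0` with radii `5/4 < 7/4`); hence `iteratedFDeriv ℝ n g x =
  iteratedFDeriv ℝ n f x` and `g x = f x` for `2 ≤ ‖x‖`.
* [our object] **`abs_boxAvg_sub_le_of_decay_off_ball`** — part 2's `abs_boxAvg_sub_le_of_decay` with `ContDiff ℝ 4 f` weakened to
  `ContDiffOn ℝ 4 f {x | 1 < ‖x‖}`: decay `‖D⁴f x‖ ≤ C₄/‖x‖^(6+j)` and `Σ_i D²f(x)(e_i,e_i) = 0` for `2 ≤ ‖x‖`, `3 ≤ ‖z‖` ⟹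
  `|∫_{box}∫_{box} f (z + u − v) − f z| ≤ ((3/2)^(6+j)/24) · C₄/‖z‖^(6+j)` (the box pair around `z` only samples `‖·‖ ≥ 2`).
Provenance: unit `b2b-balaban-gan24-formalise-leaf-04` (gen 36), 2026-08-20; no existing file touched.  0 sorry.
-/

noncomputable section

open Set MeasureTheory Metric Filter Topology
open Summit.QuantumFields.BalabanUV.Beta.FP.BoxAverageMoments
open Summit.QuantumFields.BalabanUV.Beta.FP.BoxAverageGerm

namespace Summit.QuantumFields.BalabanUV.Beta.FP.BoxAverageGermLocal

variable {ι : Type*} [Fintype ι]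

/-- [folklore] **SMOOTH EXTENSION OFF THE UNIT BALL.**  If `f : (ι → ℝ) → ℝ` is `C⁴` on the open set `{x | 1 < ‖x‖}`, there is a globally `C⁴`
function `g` agreeing with `f` in a neighbourhood of every point with `7/4 < ‖x‖` (`g := (1 − φ) · f`, `φ` a smooth bump equal to `1` on the closed
ball of radius `5/4` and to `0` off the open ball of radius `7/4`). -/
theorem exists_contDiff_extension_off_ball {f : (ι → ℝ) → ℝ} (hf : ContDiffOn ℝ 4 f {x | 1 < ‖x‖}) :
    ∃ g : (ι → ℝ) → ℝ, ContDiff ℝ 4 g ∧ ∀ x : ι → ℝ, 7 / 4 < ‖x‖ → g =ᶠ[𝓝 x] f := by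
  let φ : ContDiffBump (0 : ι → ℝ) := ⟨5 / 4, 7 / 4, by norm_num, by norm_num⟩
  refine ⟨fun x => (1 - φ x) * f x, ?_, ?_⟩
  · rw [contDiff_iff_contDiffAt]
    intro x
    by_cases hx : 1 < ‖x‖
    · have hφ : ContDiffAt ℝ 4 (fun y => 1 - φ y) x := (contDiff_const.sub φ.contDiff).contDiffAt
      exact hφ.mul (hf.contDiffAt ((isOpen_lt continuous_const continuous_norm).mem_nhds hx))
    · -- near `x` (inside the ball of radius 5/4) the cutoff kills everything
      have hx' : ‖x‖ < 5 / 4 := by linarith [not_lt.mp hx]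
      have hev : (fun y => (1 - φ y) * f y) =ᶠ[𝓝 x] fun _ => (0 : ℝ) := by
        have hU : ball (0 : ι → ℝ) (5 / 4) ∈ 𝓝 x := isOpen_ball.mem_nhds (by simpa using hx')
        filter_upwards [hU] with y hy
        have h1 : φ y = 1 := φ.one_of_mem_closedBall (ball_subset_closedBall hy)
        simp [h1]
      exact (contDiffAt_const (c := (0 : ℝ))).congr_of_eventuallyEq hev
  · intro x hx
    have hU : {y : ι → ℝ | 7 / 4 < ‖y‖} ∈ 𝓝 x := (isOpen_lt continuous_const continuous_norm).mem_nhds hx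
    filter_upwards [hU] with y hy
    have h0 : φ y = 0 := φ.zero_of_le_dist (by simpa using (le_of_lt hy))
    simp [h0]

variable [DecidableEq ι]

/-- **THE BOX-AVERAGE GERM LEMMA OFF THE UNIT BALL (decay form).**  As `BoxAverageGerm.abs_boxAvg_sub_le_of_decay`, for `f` of class `C⁴` only on
`{x | 1 < ‖x‖}`: with `‖D⁴f x‖ ≤ C₄/‖x‖^(6+j)` and `Σ_i D²f(x)(e_i,e_i) = 0` for `2 ≤ ‖x‖`, and `3 ≤ ‖z‖`,
`|∫_{box} ∫_{box} f (z + u − v) − f z| ≤ ((3/2)^(6+j)/24) · C₄/‖z‖^(6+j)`.  [our object] -/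
theorem abs_boxAvg_sub_le_of_decay_off_ball {f : (ι → ℝ) → ℝ} (hf : ContDiffOn ℝ 4 f {x | 1 < ‖x‖}) {j : ℕ} {C₄ : ℝ} (hC₄ : 0 ≤ C₄)
    (hD4 : ∀ x : ι → ℝ, 2 ≤ ‖x‖ → ‖iteratedFDeriv ℝ 4 f x‖ ≤ C₄ / ‖x‖ ^ (6 + j))
    (hΔ : ∀ x : ι → ℝ, 2 ≤ ‖x‖ → ∑ i, iteratedFDeriv ℝ 2 f x (fun _ => (Pi.single i (1 : ℝ) : ι → ℝ)) = 0)
    {z : ι → ℝ} (hz : 3 ≤ ‖z‖) :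
    |(∫ u in box ι, ∫ v in box ι, f (z + u - v)) - f z| ≤ (3 / 2 : ℝ) ^ (6 + j) / 24 * (C₄ / ‖z‖ ^ (6 + j)) := by
  obtain ⟨g, hg, hgf⟩ := exists_contDiff_extension_off_ball hf
  have hnear : ∀ x : ι → ℝ, 2 ≤ ‖x‖ → g =ᶠ[𝓝 x] f := fun x hx => hgf x (by linarith)
  have hval : ∀ x : ι → ℝ, 2 ≤ ‖x‖ → g x = f x := fun x hx => (hnear x hx).eq_of_nhds
  have hder : ∀ (n : ℕ) (x : ι → ℝ), 2 ≤ ‖x‖ → iteratedFDeriv ℝ n g x = iteratedFDeriv ℝ n f x := fun n x hx =>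
    ((hnear x hx).iteratedFDeriv ℝ n).eq_of_nhds
  have hD4g : ∀ x : ι → ℝ, 2 ≤ ‖x‖ → ‖iteratedFDeriv ℝ 4 g x‖ ≤ C₄ / ‖x‖ ^ (6 + j) := fun x hx => by
    rw [hder 4 x hx]; exact hD4 x hx
  have hΔg : ∀ x : ι → ℝ, 2 ≤ ‖x‖ → ∑ i, iteratedFDeriv ℝ 2 g x (fun _ => (Pi.single i (1 : ℝ) : ι → ℝ)) = 0 := fun x hx => by
    rw [hder 2 x hx]; exact hΔ x hx
  have h := abs_boxAvg_sub_le_of_decay hg hC₄ hD4g hΔg hz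
  -- the box pair around `z` only samples points of norm ≥ 2, where `g = f`
  have hint : (∫ u in box ι, ∫ v in box ι, g (z + u - v)) = ∫ u in box ι, ∫ v in box ι, f (z + u - v) := by
    refine setIntegral_congr_fun measurableSet_box fun u hu => ?_
    refine setIntegral_congr_fun measurableSet_box fun v hv => ?_
    refine hval _ ?_
    have h1 : ‖u - v‖ ≤ 1 := norm_sub_le_one_of_mem_box hu hv
    have h2 : ‖z‖ - ‖u - v‖ ≤ ‖z + u - v‖ := by
      have := norm_sub_norm_le z (-(u - v))
      rw [norm_neg, sub_neg_eq_add, add_sub_assoc'] at this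
      simpa [add_sub_assoc] using this
    linarith
  rw [hint, hval z (by linarith)] at h
  exact h

end Summit.QuantumFields.BalabanUV.Beta.FP.BoxAverageGermLocal

end
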